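import Summits.ABC.IUTFork.LDHGenuinePerImageSharpWildPoleLRat
import HarnessLib

/-!
# The fork at [IUTchIII] Corollary 3.12, L-DH level, READING (P): the FLOORS on the different exponent of the datum's `K` at a rational
# point with a pole at `l` — wild at `2`, W1 at `3`, `5`, `2 − 1/(l−1)` AT THE POLE `l`, tame elsewhere — as ONE NAMED LEMMA (abc-iut cell,
# crux ThetaPartII = stmt-ABC-19678; R-H round-4 row O-18, family «C:PERIMAGE-LEVEL»; input of `LDHGenuinePerImageSharpWildPoleLShellRat`)

Record-only PROOF file (D-0012) of the abc-iut cell (seat abc-iut-L5-t8, gen 14). TAKES NO SIDE on [IUTchIII] Cor. 3.12. abc-iut-rcat-tst-1's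
`Cor22.cor312PerImageOf_ratPoint_sharp_wild_poleL` (★ p541073) proves, INSIDE its proof, that at every genuine Θ-volume datum `T` of `(q, l)`
(`q ∈ ℚ ∖ {0,1}`, `j(q) = N/∏_{p∈I} p^{e_p}`, pole `l ∈ I` of order `e_l = 2t`, `l ∤ t`) the floors
`B_p·e(w∣p) ≤ ord_w 𝔇_{K/ℤ}` hold at every place `w ∣ p` of `K`, with `B_p = χ_p − 1/m_p` at the poles `p ≠ 2, l` (`χ_p = 2` at a W1 pole
over `3`, `5`, else `1`; `m_p = l·lcm(30/gcd(30,e_p), c_p)`), `B_2 = 1` (`√−1 ∈ K`), `B_l = 2 − 1/(l−1)` (★ p539739), `B_3 = ½`, `B_5 = ¾` off `I`.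
THIS FILE states exactly that as a lemma, **`Cor22.ThetaVolumeDatumAt.floors_sharp_wild_poleL_ratPoint`**, proof verbatim from ★ p541073
(every divisibility CONSUMED BY NAME from its sources: `under_ratPoint_spec`, `mem_badPlacesAvoid_ratPoint_of_natGenerator_eq`,
`l_dvd_ramificationIdx'_of_mem_badPlacesAvoid`, `div_gcd_thirty_dvd_ramificationIdx_F`, `sub_one_dvd_ramificationIdx_int`,
`dvd_ramificationIdx'_ratPoint_of_forall`, `ramificationIdx_le_multiplicity_differentIdeal_over_two`,
`GenuineK.sub_one_le_multiplicity_differentIdeal_placeOf_wild_ratPoint`, `GenuineK.sub_one_le_multiplicity_differentIdeal_placeOf_pole_ratPoint`,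
`sub_one_dvd_ramificationIdx'_ratPoint_l`, `sub_one_dvd_ramificationIdx'_ratPoint_of_dvd_thirty`), so that other one-`l` tests (the shell merge
`LDHGenuinePerImageSharpWildPoleLShellRat`) can feed `ThetaVolumeDatumAt.cor312PerImageOf_of_le_floor` / `…_of_le_floor_shell` without re-deriving it.

Classical algebraic number theory around the cell's typed objects; nothing here asserts the existence of Θ-data, Cor. 3.12 in general or in
print's reading, or abc. [cite: Mochizuki2012, IUTchI Def. 3.1 (a)(b)(c) p. 61–62; IUTchIV Thm. 1.10 p. 22, Step (ii) p. 24, Step (v) p. 27–29]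
[cite: MochizukiGenEll2010, Prop. 1.7 (i) p. 9–10] [cite: SilvermanATAEC1994, V.5 Thm. 5.3] [cite: SerreLocalFields1979, Ch. III §6 Prop. 13]
[cite: NeukirchANT1999, Ch. III (2.6)] [claim: Mochizuki2012, status: disputed] for every IUT quotation. PROOF-ONLY: no definitions, no new `Prop`,
no instance, no notation.
-/

noncomputable section

open NumberField IsDedekindDomain Ideal Module

namespace Literature.IUT.LogVolume.Cor22

open Literature.NumberTheory.DiophantineGeometry.GenEll Summit.ABC.IUTFork Literature.IUT.HodgeTheaters
open Literature.NumberTheory.NumberFields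
open Literature.NumberTheory.DiophantineGeometry.UniformABCConjecture Rat.HeightOneSpectrum
open Summit.ABC.IUTFork.Thm311.Real Summit.ABC.IUTFork.Conditional Summit.ABC.IUTFork.Cor312Prov
open Literature.IUT.LogThetaLattice

/-- The floor arithmetic: `m ∣ e`, `e > 0`, `A·e − 1 ≤ D` ⟹ `(A − 1/m)·e ≤ D` (★ p541073's private `floor_mul_le_pl`). [folklore] -/
private theorem floor_mul_le_fs {A : ℝ} {m e D : ℕ} (hm : 0 < m) (hme : m ∣ e) (he : 0 < e)
    (hD : A * e - 1 ≤ (D : ℝ)) : (A - (m : ℝ)⁻¹) * (e : ℝ) ≤ (D : ℝ) := by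
  have hmle : (m : ℝ) ≤ e := by exact_mod_cast Nat.le_of_dvd he hme
  have hm0 : (0 : ℝ) < m := by exact_mod_cast hm
  have h1 : 1 ≤ (m : ℝ)⁻¹ * e := by
    rw [le_inv_mul_iff₀ hm0]; simpa using hmle
  nlinarith

namespace ThetaVolumeDatumAt

variable {q : ℚ} {l : ℕ} (T : ThetaVolumeDatumAt (ratPoint q) l) {N D : ℕ} {I : Finset ℕ} {e : ℕ → ℕ}

/-- **THE FLOORS AT A GENUINE DATUM OF A RATIONAL POINT WITH A POLE AT `l`** (statement in words in the module docstring): for every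
`p ∈ {p ∈ I : p ≠ 2, l} ∪ {2, l} ∪ ({3,5} ∖ I)` and every place `w ∣ p` of the datum's `K`, `B_p·e(w∣p) ≤ ord_w 𝔇_{K/ℤ}` with the displayed
`B_p`. Proof verbatim from ★ p541073 (abc-iut-rcat-tst-1), whose sources are consumed BY NAME. [cite: Mochizuki2012, IUTchI Def. 3.1 (a)(b)(c)
p. 61–62; IUTchIV Thm. 1.10 Step (ii) p. 24] [cite: SerreLocalFields1979, Ch. III §6 Prop. 13] [claim: Mochizuki2012, status: disputed] -/
theorem floors_sharp_wild_poleL_ratPoint (hl : l.Prime) (h7 : 7 ≤ l)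
    (hI : ∀ p ∈ I, p.Prime) (he : ∀ p ∈ I, e p ≠ 0) (hD : D = ∏ p ∈ I, p ^ e p)
    (hj : jInv q = (N : ℚ) / (D : ℚ)) (hN : N ≠ 0) (hcop : ∀ p ∈ I, ¬ p ∣ N)
    (hlI : l ∈ I) (hel : 2 ∣ e l) (hlt : ¬ l ∣ e l / 2) :
    letI := T.instFieldK; letI := T.instNumberFieldK
    ∀ p ∈ I.filter (fun p => p ≠ 2 ∧ p ≠ l) ∪ ({2, l} ∪ ({3, 5} \ I)), ∀ w ∈ placesOver T.K p,
      (if p ∈ I ∧ (p ≠ 2 ∧ p ≠ l) then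
          (if (p = 3 ∨ p = 5) ∧ 2 ∣ e p ∧ ¬ p ∣ e p / 2 then (2 : ℝ) else 1)
            - ((l * Nat.lcm (30 / Nat.gcd 30 (e p)) (if p = 3 then 2 else if p = 5 then 4 else 1) : ℕ) : ℝ)⁻¹
        else if p = 2 then 1 else if p = l then 2 - ((l - 1 : ℕ) : ℝ)⁻¹ else if p = 5 then 1 - 4⁻¹ else 1 - 2⁻¹)
        * (w.asIdeal.ramificationIdx ℤ : ℝ) ≤ (multiplicity w.asIdeal (differentIdeal ℤ (𝓞 T.K)) : ℝ) := by
  classical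
  -- verbatim from ★ p541073's proof of `cor312PerImageOf_ratPoint_sharp_wild_poleL` (abc-iut-rcat-tst-1), floors part
  letI := T.instFieldF; letI := T.instNumberFieldF; letI := T.instAlgebraF; letI := T.instFieldK
  letI := T.instNumberFieldK; letI := T.instAlgebraK; letI := T.instFieldFbar; letI := T.instAlgebraFbar
  letI := T.instAlgebraKFbar; letI := T.instIsElliptic
  letI : Algebra (ratPoint q).F T.K := ((algebraMap T.F T.K).comp (algebraMap (ratPoint q).F T.F)).toAlgebra
  have hl2 : l ≠ 2 := by omega
  have hl3 : l ≠ 3 := by omega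
  have hl5 : l ≠ 5 := by omega

  -- the primes carrying a floor
  obtain ⟨Ps, hPs⟩ : ∃ Ps : Finset ℕ, Ps = I.filter (fun p => p ≠ 2 ∧ p ≠ l) ∪ ({2, l} ∪ ({3, 5} \ I)) := ⟨_, rfl⟩
  have hPs_prime : ∀ p ∈ Ps, p.Prime := by
    intro p hp
    rw [hPs] at hp
    rcases Finset.mem_union.mp hp with h | h
    · exact hI p (Finset.mem_filter.mp h).1
    · rcases Finset.mem_union.mp h with h | h
      · rcases Finset.mem_insert.mp h with rfl | h
        · exact Nat.prime_two
        · rw [Finset.mem_singleton] at h; subst h; exact hl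
      · have h35 := (Finset.mem_sdiff.mp h).1
        rcases Finset.mem_insert.mp h35 with rfl | h35
        · norm_num
        · rw [Finset.mem_singleton] at h35; subst h35; norm_num
  -- the floors
  obtain ⟨mA, hmA⟩ : ∃ mA : ℕ → ℕ, mA = fun p =>
      l * Nat.lcm (30 / Nat.gcd 30 (e p)) (if p = 3 then 2 else if p = 5 then 4 else 1) := ⟨_, rfl⟩
  obtain ⟨B, hB⟩ : ∃ B : ℕ → ℝ, B = fun p =>
      if p ∈ I ∧ (p ≠ 2 ∧ p ≠ l) then
        (if (p = 3 ∨ p = 5) ∧ 2 ∣ e p ∧ ¬ p ∣ e p / 2 then (2 : ℝ) else 1) - (mA p : ℝ)⁻¹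
      else if p = 2 then 1 else if p = l then 2 - ((l - 1 : ℕ) : ℝ)⁻¹
      else if p = 5 then 1 - 4⁻¹ else 1 - 2⁻¹ := ⟨_, rfl⟩
  have hcpos : ∀ p, 0 < (if p = 3 then 2 else if p = 5 then 4 else 1 : ℕ) := by
    intro p; split_ifs <;> norm_num
  have hrpos : ∀ p, 0 < 30 / Nat.gcd 30 (e p) := fun p =>
    Nat.div_pos (Nat.gcd_le_left _ (by norm_num)) (Nat.gcd_pos_of_pos_left _ (by norm_num))
  have hlcmpos : ∀ p, 0 < Nat.lcm (30 / Nat.gcd 30 (e p)) (if p = 3 then 2 else if p = 5 then 4 else 1) :=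
    fun p => Nat.lcm_pos (hrpos p) (hcpos p)
  have hmApos : ∀ p, 0 < mA p := fun p => by
    rw [hmA]; exact Nat.mul_pos hl.pos (hlcmpos p)
  have hBA : ∀ p ∈ I.filter (fun p => p ≠ 2 ∧ p ≠ l),
      B p = (if (p = 3 ∨ p = 5) ∧ 2 ∣ e p ∧ ¬ p ∣ e p / 2 then (2 : ℝ) else 1)
        - ((l * Nat.lcm (30 / Nat.gcd 30 (e p)) (if p = 3 then 2 else if p = 5 then 4 else 1) : ℕ) : ℝ)⁻¹ := by
    intro p hp
    obtain ⟨hpI, hp2l⟩ := Finset.mem_filter.mp hp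
    simp only [hB, hmA, if_pos (And.intro hpI hp2l)]
  have hB2 : B 2 = 1 := by simp [hB]
  have hBl : B l = 2 - ((l - 1 : ℕ) : ℝ)⁻¹ := by simp [hB, hl2]
  have hB3 : 3 ∉ I → B 3 = 1 - 2⁻¹ := fun h3 => by simp [hB, h3, Ne.symm hl3]
  have hB5 : 5 ∉ I → B 5 = 1 - 4⁻¹ := fun h5 => by simp [hB, h5, Ne.symm hl5]
  -- the floors are theorems at `T.K` (verbatim from ★ p541073's proof)
  have hfloor : ∀ p ∈ Ps, ∀ w ∈ placesOver T.K p,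
      B p * (w.asIdeal.ramificationIdx ℤ : ℝ) ≤ (multiplicity w.asIdeal (differentIdeal ℤ (𝓞 T.K)) : ℝ) := by
    intro p hp w hw
    have hpp : p.Prime := hPs_prime p hp
    haveI : Fact p.Prime := ⟨hpp⟩
    have hpw : ((p : ℕ) : 𝓞 T.K) ∈ w.asIdeal := by
      have h := (mem_placesOver_iff w).mp hw
      have hmem : ((p : ℕ) : ℤ) ∈ w.asIdeal.under ℤ := by
        rw [← h.over]; exact Ideal.mem_span_singleton_self _
      have := Ideal.mem_comap.mp hmem
      simpa using this
    obtain ⟨hpv, hwv, hconv⟩ := T.under_ratPoint_spec w hpw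
    set v := w.under (𝓞 (ratPoint q).F) with hvdef
    have hgen : natGenerator (show HeightOneSpectrum (𝓞 ℚ) from v) = p :=
      (Nat.prime_dvd_prime_iff_eq (prime_natGenerator (show HeightOneSpectrum (𝓞 ℚ) from v)) hpp).mp
        ((natCast_mem_asIdeal_iff (show HeightOneSpectrum (𝓞 ℚ) from v) p).mp hpv)
    have he0 : 0 < w.asIdeal.ramificationIdx ℤ := Ideal.ramificationIdx_pos _ _
    have htame : w.asIdeal.ramificationIdx ℤ - 1 ≤ multiplicity w.asIdeal (differentIdeal ℤ (𝓞 T.K)) :=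
      ramificationIdx_int_sub_one_le_multiplicity w
    have htameR : (1 : ℝ) * (w.asIdeal.ramificationIdx ℤ : ℝ) - 1 ≤
        (multiplicity w.asIdeal (differentIdeal ℤ (𝓞 T.K)) : ℝ) := by
      have h' : w.asIdeal.ramificationIdx ℤ ≤ multiplicity w.asIdeal (differentIdeal ℤ (𝓞 T.K)) + 1 := by omega
      have h'' : (w.asIdeal.ramificationIdx ℤ : ℝ) ≤ (multiplicity w.asIdeal (differentIdeal ℤ (𝓞 T.K)) : ℝ) + 1 := by
        exact_mod_cast h'
      linarith
    rw [hPs] at hp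
    rcases Finset.mem_union.mp hp with hpA | hpBC
    · obtain ⟨hpI, hp2, hpl⟩ := Finset.mem_filter.mp hpA
      have hpS : ∀ s ∈ ({2, l} : Finset ℕ), ¬ p ∣ s := by
        intro s hs hps
        simp only [Finset.mem_insert, Finset.mem_singleton] at hs
        rcases hs with rfl | rfl
        · exact hp2 ((Nat.prime_dvd_prime_iff_eq hpp Nat.prime_two).mp hps)
        · exact hpl ((Nat.prime_dvd_prime_iff_eq hpp hl).mp hps)
      have hbad : (show HeightOneSpectrum (𝓞 ℚ) from v) ∈ badPlacesAvoid (ratPoint q) {2, l} :=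
        mem_badPlacesAvoid_ratPoint_of_natGenerator_eq hI he hD hj hN {2, l} hpI (hcop p hpI) hpS _ hgen
      have hldvd := ThetaVolumeDatumAt.l_dvd_ramificationIdx'_of_mem_badPlacesAvoid T v hbad w.asIdeal hwv
      have hkF : ∀ x : HeightOneSpectrum (𝓞 T.F), ((p : ℕ) : 𝓞 T.F) ∈ x.asIdeal →
          Nat.lcm (30 / Nat.gcd 30 (e p)) (if p = 3 then 2 else if p = 5 then 4 else 1) ∣
            x.asIdeal.ramificationIdx ℤ := by
        intro x hx
        refine Nat.lcm_dvd (T.div_gcd_thirty_dvd_ramificationIdx_F hI he hD hj hN hpI (hcop p hpI) x hx) ?_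
        by_cases h3 : p = 3
        · rw [if_pos h3]; subst h3
          exact T.sub_one_dvd_ramificationIdx_int (by norm_num) (by norm_num) x hx
        · rw [if_neg h3]
          by_cases h5 : p = 5
          · rw [if_pos h5]; subst h5
            exact T.sub_one_dvd_ramificationIdx_int (by norm_num) (by norm_num) x hx
          · rw [if_neg h5]; exact one_dvd _
      have hkdvd := T.dvd_ramificationIdx'_ratPoint_of_forall hkF v hpv w.asIdeal hwv
      have hcop60 : Nat.Coprime (Nat.lcm (30 / Nat.gcd 30 (e p)) (if p = 3 then 2 else if p = 5 then 4 else 1)) l := by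
        have h60 : Nat.lcm (30 / Nat.gcd 30 (e p)) (if p = 3 then 2 else if p = 5 then 4 else 1) ∣ 60 := by
          refine Nat.lcm_dvd ((Nat.div_dvd_of_dvd (Nat.gcd_dvd_left 30 (e p))).trans (by norm_num)) ?_
          split_ifs <;> norm_num
        have hc : Nat.Coprime 60 l := by
          have h2 : Nat.Coprime 2 l := (Nat.coprime_primes Nat.prime_two hl).mpr hl2.symm
          have h3 : Nat.Coprime 3 l := (Nat.coprime_primes (by norm_num) hl).mpr hl3.symm
          have h5 : Nat.Coprime 5 l := (Nat.coprime_primes (by norm_num) hl).mpr hl5.symm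
          have : (60 : ℕ) = 2 * 2 * 3 * 5 := by norm_num
          rw [this]
          exact ((h2.mul_left h2).mul_left h3).mul_left h5
        exact Nat.Coprime.coprime_dvd_left h60 hc
      have hmdvd : l * Nat.lcm (30 / Nat.gcd 30 (e p)) (if p = 3 then 2 else if p = 5 then 4 else 1) ∣
          w.asIdeal.ramificationIdx ℤ := by
        rw [← hconv, mul_comm]
        exact hcop60.mul_dvd_of_dvd_of_dvd hkdvd hldvd
      have hmpos : 0 < l * Nat.lcm (30 / Nat.gcd 30 (e p)) (if p = 3 then 2 else if p = 5 then 4 else 1) := by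
        have h0 := hmApos p
        simp only [hmA] at h0
        exact h0
      rw [hBA p hpA]
      by_cases hW1 : (p = 3 ∨ p = 5) ∧ 2 ∣ e p ∧ ¬ p ∣ e p / 2
      · rw [if_pos hW1]
        obtain ⟨hp35, h2e, hpt⟩ := hW1
        have hp30 : p ∣ 30 := by rcases hp35 with rfl | rfl <;> norm_num
        obtain ⟨t, ht⟩ := h2e
        have ht0 : 0 < t := by
          rcases Nat.eq_zero_or_pos t with h0 | h0
          · exfalso; apply he p hpI; rw [ht, h0]
          · exact h0
        have hpt' : ¬ p ∣ t := by rwa [ht, Nat.mul_div_cancel_left t (by norm_num : 0 < 2)] at hpt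
        have hpole : ∀ v' : HeightOneSpectrum (𝓞 ℚ), natGenerator v' = (⟨p, hpp⟩ : Nat.Primes) →
            ord ℚ v' (jInv q) = -(2 * (t : ℤ)) := by
          intro v' hv'
          have h1 := ord_jInv_ratPoint_of_mem hI hD hj hN v' (by rw [hv']; exact hpI) (by rw [hv']; exact hcop p hpI)
          rw [h1, hv']
          change -((e p : ℕ) : ℤ) = _
          rw [ht]; push_cast; ring
        have hwild := GenuineK.sub_one_le_multiplicity_differentIdeal_placeOf_wild_ratPoint T ⟨p, hpp⟩ hp30 hp2 ht0 hpt'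
          hpole ((fibreEquivPlacesOver (pilotDataOfK T.D T.K) ⟨p, hpp⟩).symm ⟨w, hw⟩)
        have hplace : placeOf (pilotDataOfK T.D T.K) p
            ((fibreEquivPlacesOver (pilotDataOfK T.D T.K) ⟨p, hpp⟩).symm ⟨w, hw⟩) = w := by
          show ((fibreEquivPlacesOver (pilotDataOfK T.D T.K) ⟨p, hpp⟩)
            ((fibreEquivPlacesOver (pilotDataOfK T.D T.K) ⟨p, hpp⟩).symm ⟨w, hw⟩)).1 = w
          rw [Equiv.apply_symm_apply]
        rw [hplace] at hwild
        refine floor_mul_le_fs hmpos hmdvd he0 ?_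
        have h' : 2 * w.asIdeal.ramificationIdx ℤ ≤ multiplicity w.asIdeal (differentIdeal ℤ (𝓞 T.K)) + 1 := by omega
        have h'' : (2 : ℝ) * (w.asIdeal.ramificationIdx ℤ : ℝ) ≤
            (multiplicity w.asIdeal (differentIdeal ℤ (𝓞 T.K)) : ℝ) + 1 := by exact_mod_cast h'
        linarith
      · rw [if_neg hW1]
        exact floor_mul_le_fs hmpos hmdvd he0 htameR
    · rcases Finset.mem_union.mp hpBC with hpB | hpC
      · rcases Finset.mem_insert.mp hpB with rfl | hpB
        · rw [hB2, one_mul]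
          exact_mod_cast T.ramificationIdx_le_multiplicity_differentIdeal_over_two w hpw
        · rw [Finset.mem_singleton] at hpB
          subst hpB
          rw [hBl]
          have hdvd : (p - 1) ∣ w.asIdeal.ramificationIdx ℤ := by
            rw [← hconv]; exact T.sub_one_dvd_ramificationIdx'_ratPoint_l v hpv w.asIdeal hwv
          obtain ⟨t, ht⟩ := hel
          have ht0 : 0 < t := by
            rcases Nat.eq_zero_or_pos t with h0 | h0
            · exfalso; apply he p hlI; rw [ht, h0]
            · exact h0
          have hpt' : ¬ p ∣ t := by rwa [ht, Nat.mul_div_cancel_left t (by norm_num : 0 < 2)] at hlt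
          have hpole : ∀ v' : HeightOneSpectrum (𝓞 ℚ), natGenerator v' = p →
              ord ℚ v' (jInv q) = -(2 * (t : ℤ)) := by
            intro v' hv'
            have h1 := ord_jInv_ratPoint_of_mem hI hD hj hN v' (by rw [hv']; exact hlI) (by rw [hv']; exact hcop p hlI)
            rw [h1, hv']
            change -((e p : ℕ) : ℤ) = _
            rw [ht]; push_cast; ring
          have hwild := GenuineK.sub_one_le_multiplicity_differentIdeal_placeOf_pole_ratPoint T hpp ht0 hpt'
            hpole ((fibreEquivPlacesOver (pilotDataOfK T.D T.K) ⟨p, hpp⟩).symm ⟨w, hw⟩)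
          have hplace : placeOf (pilotDataOfK T.D T.K) p
              ((fibreEquivPlacesOver (pilotDataOfK T.D T.K) ⟨p, hpp⟩).symm ⟨w, hw⟩) = w := by
            show ((fibreEquivPlacesOver (pilotDataOfK T.D T.K) ⟨p, hpp⟩)
              ((fibreEquivPlacesOver (pilotDataOfK T.D T.K) ⟨p, hpp⟩).symm ⟨w, hw⟩)).1 = w
            rw [Equiv.apply_symm_apply]
          rw [hplace] at hwild
          refine floor_mul_le_fs (by omega) hdvd he0 ?_
          have h' : 2 * w.asIdeal.ramificationIdx ℤ ≤ multiplicity w.asIdeal (differentIdeal ℤ (𝓞 T.K)) + 1 := by omega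
          have h'' : (2 : ℝ) * (w.asIdeal.ramificationIdx ℤ : ℝ) ≤
              (multiplicity w.asIdeal (differentIdeal ℤ (𝓞 T.K)) : ℝ) + 1 := by exact_mod_cast h'
          linarith
      · obtain ⟨h35, hnot⟩ := Finset.mem_sdiff.mp hpC
        rcases Finset.mem_insert.mp h35 with rfl | h35
        · rw [hB3 hnot]
          have hdvd : (3 - 1) ∣ w.asIdeal.ramificationIdx ℤ := by
            rw [← hconv]
            exact T.sub_one_dvd_ramificationIdx'_ratPoint_of_dvd_thirty (by norm_num) (by norm_num) v hpv w.asIdeal hwv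
          exact floor_mul_le_fs (by norm_num) hdvd he0 htameR
        · rw [Finset.mem_singleton] at h35
          subst h35
          rw [hB5 hnot]
          have hdvd : (5 - 1) ∣ w.asIdeal.ramificationIdx ℤ := by
            rw [← hconv]
            exact T.sub_one_dvd_ramificationIdx'_ratPoint_of_dvd_thirty (by norm_num) (by norm_num) v hpv w.asIdeal hwv
          exact floor_mul_le_fs (by norm_num) hdvd he0 htameR
  intro p hp w hw
  have hval : (if p ∈ I ∧ (p ≠ 2 ∧ p ≠ l) then
          (if (p = 3 ∨ p = 5) ∧ 2 ∣ e p ∧ ¬ p ∣ e p / 2 then (2 : ℝ) else 1)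
            - ((l * Nat.lcm (30 / Nat.gcd 30 (e p)) (if p = 3 then 2 else if p = 5 then 4 else 1) : ℕ) : ℝ)⁻¹
        else if p = 2 then 1 else if p = l then 2 - ((l - 1 : ℕ) : ℝ)⁻¹ else if p = 5 then 1 - 4⁻¹ else 1 - 2⁻¹) = B p := by
    rw [hB, hmA]
  rw [hval]
  exact hfloor p (by rw [hPs]; exact hp) w hw

end ThetaVolumeDatumAt

end Literature.IUT.LogVolume.Cor22

end
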